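import Literature.MathematicalPhysics.QuantumManyBody.PeriodicWeightedFormCore
import Literature.MathematicalPhysics.QuantumManyBody.PeriodicMaxFormBound
import HarnessLib

/-!
# The maximal-form bound for an abstract integrable weight: the `C¹` Bose core realises the infimum

Topic `Literature/MathematicalPhysics/QuantumManyBody`, sequel of `PeriodicWeightedFormCore.lean`;
abstract-weight twin of `PeriodicMaxFormBoundBounded.lean` and `PeriodicMaxFormBound.lean` (same statements and
proofs with `periodicInteraction w L ↦ W`, under `hWm : Measurable W`, `hW : ∫⁻ X in cellN N L, W X ≠ ⊤`).
**Main result** (`periodicGroundStateEnergyW_mul_le_maxFormW`, B. Simon's form-core theorem for `-∑ⱼΔⱼ + W` with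
`0 ≤ W ∈ L¹` of the cell, in the Bose sector [Simon1979Forms, Thm. 2.1]): for every `η ∈ L²((ℝ/ℤ)^{3N})` that
is Bose-symmetric in momentum space,

  `E₀(W) · ‖η‖² ≤ ∑ₙ (∑ₚ (2πnₚ/L)²) |⟪eₙ, η⟫|² + ∫ (W ∘ fromUnitTorusN L) |η|²`,  `E₀(W) = periodicGroundStateEnergyW W L`.

Bounded classes first (`exists_symm_trigPoly_maxFormW_approx`, `periodicGroundStateEnergyW_mul_le_maxFormW_of_bound`:
box-kernel smoothing into Bose-symmetric trigonometric polynomials with dominated Fourier coefficients, dominated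
convergence of the potential energies along an a.e.-convergent subsequence), then Lipschitz truncation
(`clampLp`, the pair file's `W`-independent clamp lemmas) and dominated convergence of the norms.

## References
* B. Simon, *Maximal and minimal Schrödinger forms*, J. Operator Theory 1 (1979) 37–47, Thm. 2.1 [Simon1979Forms].
* [ReedSimonIV1978] Reed–Simon IV, Thm. XIII.64; T. Kato, *Perturbation Theory*, VI §1.3–1.4.
-/

noncomputable section

open MeasureTheory Filter Set WithLp Complex UnitAddTorus
open scoped ENNReal NNReal Topology ComplexConjugate InnerProductSpace
open Literature.Analysis.FunctionSpaces Literature.Analysis.OperatorTheory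

namespace Literature.MathematicalPhysics.QuantumManyBody.BoseGas

-- The measure on `ℝ/ℤ` is the Haar PROBABILITY measure, as in `PeriodicFormDomain.lean`.
attribute [local instance] formDomain_measureSpace formDomain_isProbabilityMeasure formDomain_isProbabilityMeasure_pi

variable {N : ℕ} {L : ℝ} {W : Config N → ℝ≥0∞}

/-- Local notation for the Hilbert space `H = L²((ℝ/ℤ)^{3N})`. -/
local notation "L2T " N':max => Lp ℂ 2 (volume : Measure (UnitAddTorus (Fin N' × Fin 3)))

/-- The transported interaction `W ∘ fromUnitTorusN` is integrable on the torus when `W` is integrable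
on the cell: `∫ (W ∘ fromUnitTorusN L) = L^{-3N} ∫_{[0,L)^{3N}} W`. [folklore] -/
theorem lintegral_weight_fromUnitTorusN_ne_top (hL : 0 < L) (hWm : Measurable W)
    (hW : ∫⁻ X in cellN N L, W X ≠ ⊤) :
    ∫⁻ t : UnitAddTorus (Fin N × Fin 3), W (fromUnitTorusN L t) ≠ ⊤ := by
  rw [lintegral_fromUnitTorusN hL hWm]
  exact ENNReal.mul_ne_top (ENNReal.pow_ne_top (ENNReal.inv_ne_top.2
    (pow_ne_zero 3 (ENNReal.ofReal_pos.2 hL).ne'))) hW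



/-- **Bounded Bose-symmetric classes are approximated in the maximal form by Bose-symmetric trigonometric
polynomials.** Let `L > 0`, `W` a measurable weight with `∫_{[0,L)^{3N}} W < ∞`,
and `f ∈ L²((ℝ/ℤ)^{3N})` with `‖f‖ ≤ C` a.e. and Bose-symmetric Fourier coefficients. For every `ε > 0` there is
a trigonometric polynomial `P = ∑_{n ∈ S} aₙ eₙ` with `S` stable under the particle permutations and `a`
invariant under them, whose spectral kinetic energy is at most that of `f`, with
`∫ (W ∘ fromUnitTorusN L)|P|² ≤ ∫ (W ∘ fromUnitTorusN L)|f|² + ε` and `‖P - f‖ ≤ ε`.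
[cite: ReedSimonIV1978, Thm. XIII.64] -/
theorem exists_symm_trigPoly_maxFormW_approx (hL : 0 < L) (hWm : Measurable W)
    (hW : ∫⁻ X in cellN N L, W X ≠ ⊤) (f : L2T N) {C : ℝ}
    (hC : ∀ᵐ t ∂(volume : Measure (UnitAddTorus (Fin N × Fin 3))), ‖(f : UnitAddTorus (Fin N × Fin 3) → ℂ) t‖ ≤ C)
    (hsymm : ∀ (σ : Equiv.Perm (Fin N)) (n : Fin N × Fin 3 → ℤ),
      ⟪(mFourierLp 2 (fun p : Fin N × Fin 3 => n (σ p.1, p.2)) : L2T N), f⟫_ℂ = ⟪(mFourierLp 2 n : L2T N), f⟫_ℂ)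
    {ε : ℝ} (hε : 0 < ε) :
    ∃ (S : Finset (Fin N × Fin 3 → ℤ)) (a : (Fin N × Fin 3 → ℤ) → ℂ),
      (∀ (σ : Equiv.Perm (Fin N)) (n : Fin N × Fin 3 → ℤ), n ∈ S → (fun p => n (σ p.1, p.2)) ∈ S) ∧
      (∀ (σ : Equiv.Perm (Fin N)) (n : Fin N × Fin 3 → ℤ), a (fun p => n (σ p.1, p.2)) = a n) ∧
      (∑' n : Fin N × Fin 3 → ℤ, ENNReal.ofReal (∑ p, (2 * Real.pi * (n p : ℝ) / L) ^ 2) *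
          (‖⟪(mFourierLp 2 n : L2T N), ∑ m ∈ S, a m • (mFourierLp 2 m : L2T N)⟫_ℂ‖₊ : ℝ≥0∞) ^ 2 ≤
        ∑' n : Fin N × Fin 3 → ℤ, ENNReal.ofReal (∑ p, (2 * Real.pi * (n p : ℝ) / L) ^ 2) *
          (‖⟪(mFourierLp 2 n : L2T N), f⟫_ℂ‖₊ : ℝ≥0∞) ^ 2) ∧
      (∫⁻ t, W (fromUnitTorusN L t) *
          (‖((∑ m ∈ S, a m • (mFourierLp 2 m : L2T N) : L2T N) : UnitAddTorus (Fin N × Fin 3) → ℂ) t‖₊ : ℝ≥0∞) ^ 2 ≤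
        (∫⁻ t, W (fromUnitTorusN L t) *
          (‖(f : UnitAddTorus (Fin N × Fin 3) → ℂ) t‖₊ : ℝ≥0∞) ^ 2) + ENNReal.ofReal ε) ∧
      ‖(∑ m ∈ S, a m • (mFourierLp 2 m : L2T N)) - f‖ ≤ ε := by
  classical
  -- notation
  set KIN : L2T N → ℝ≥0∞ := fun g => ∑' n : Fin N × Fin 3 → ℤ,
    ENNReal.ofReal (∑ p, (2 * Real.pi * (n p : ℝ) / L) ^ 2) * (‖⟪(mFourierLp 2 n : L2T N), g⟫_ℂ‖₊ : ℝ≥0∞) ^ 2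
    with hKIN
  set Wt : UnitAddTorus (Fin N × Fin 3) → ℝ≥0∞ := fun t => W (fromUnitTorusN L t) with hWt
  set POT : L2T N → ℝ≥0∞ := fun g => ∫⁻ t, Wt t * (‖(g : UnitAddTorus (Fin N × Fin 3) → ℂ) t‖₊ : ℝ≥0∞) ^ 2
    with hPOT
  have hWtm : Measurable Wt := hWm.comp (measurable_fromUnitTorusN L)
  have hWtint : ∫⁻ t, Wt t ≠ ⊤ := lintegral_weight_fromUnitTorusN_ne_top hL hWm hW
  -- the approximating trigonometric polynomials
  have hδ : ∀ j : ℕ, (0 : ℝ) < 1 / ((j : ℝ) + 1) := fun j => by positivity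
  choose R m hm1 hmσ hsup hdist using fun j : ℕ => HaarTorus.exists_trigPoly_approx_of_bound f hC (hδ j)
  set box : ℕ → Finset (Fin N × Fin 3 → ℤ) := fun j => Fintype.piFinset fun _ : Fin N × Fin 3 => Finset.Icc (-(R j : ℤ)) (R j)
    with hbox
  set a : ℕ → (Fin N × Fin 3 → ℤ) → ℂ := fun j n => m j n * mFourierCoeff f n with ha
  set P : ℕ → L2T N := fun j => ∑ n ∈ box j, a j n • (mFourierLp 2 n : L2T N) with hP
  -- (i) `P j → f` in `L²`
  have hPf : Tendsto P atTop (𝓝 f) := by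
    rw [tendsto_iff_norm_sub_tendsto_zero]
    refine squeeze_zero (fun j => norm_nonneg _) (fun j => hdist j) tendsto_one_div_add_atTop_nhds_zero_nat
  -- (ii) `P j` is bounded by `C + 1` a.e.
  have hPbd : ∀ j, ∀ᵐ t ∂(volume : Measure (UnitAddTorus (Fin N × Fin 3))),
      ‖(P j : UnitAddTorus (Fin N × Fin 3) → ℂ) t‖ ≤ C + 1 := fun j => by
    filter_upwards [HaarTorus.coeFn_sum_smul_mFourierLp (box j) (a j)] with t ht
    simp only [hP]
    rw [ht]
    refine (hsup j t).trans (add_le_add le_rfl ?_)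
    rw [div_le_one (by positivity)]
    linarith [(Nat.cast_nonneg j : (0 : ℝ) ≤ j)]
  -- (iii) symmetry of boxes and coefficients
  have hboxσ : ∀ j (σ : Equiv.Perm (Fin N)) (n : Fin N × Fin 3 → ℤ), n ∈ box j →
      (fun p : Fin N × Fin 3 => n (σ p.1, p.2)) ∈ box j := fun j σ n hn => by
    rw [← comp_prodCongr_eq]
    exact (HaarTorus.comp_perm_mem_box_iff (R j) _ n).2 hn
  have haσ : ∀ j (σ : Equiv.Perm (Fin N)) (n : Fin N × Fin 3 → ℤ), a j (fun p => n (σ p.1, p.2)) = a j n := by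
    intro j σ n
    simp only [ha]
    rw [← comp_prodCongr_eq, hmσ j, comp_prodCongr_eq, ← HaarTorus.inner_mFourierLp_eq_mFourierCoeff,
      ← HaarTorus.inner_mFourierLp_eq_mFourierCoeff, hsymm]
  -- (iv) the kinetic energies are dominated by that of `f`
  have hkin : ∀ j, KIN (P j) ≤ KIN f := fun j => by
    refine ENNReal.tsum_le_tsum fun n => mul_le_mul_right ?_ _
    have hle : (‖⟪(mFourierLp 2 n : L2T N), P j⟫_ℂ‖₊ : ℝ≥0∞) ≤ ‖⟪(mFourierLp 2 n : L2T N), f⟫_ℂ‖₊ := by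
      refine ENNReal.coe_le_coe.2 ?_
      simp only [hP]
      rw [HaarTorus.inner_mFourierLp_sum_smul, HaarTorus.inner_mFourierLp_eq_mFourierCoeff]
      split_ifs
      · simp only [ha, nnnorm_mul]
        refine mul_le_of_le_one_left bot_le (NNReal.coe_le_coe.1 ?_)
        rw [coe_nnnorm, NNReal.coe_one]
        exact hm1 j n
      · simp
    exact pow_le_pow_left' hle 2
  -- (v) the potential energies converge along an a.e.-convergent subsequence
  obtain ⟨φ, hφ, hae⟩ := (tendstoInMeasure_of_tendsto_Lp hPf).exists_seq_tendsto_ae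
  have hpot : Tendsto (fun i => POT (P (φ i))) atTop (𝓝 (POT f)) := by
    refine tendsto_lintegral_of_dominated_convergence' (fun t => Wt t * ENNReal.ofReal ((C + 1) ^ 2))
      (fun i => hWtm.aemeasurable.mul
        ((Lp.aestronglyMeasurable (P (φ i))).aemeasurable.nnnorm.coe_nnreal_ennreal.pow_const 2)) ?_ ?_ ?_
    · intro i
      filter_upwards [hPbd (φ i)] with t ht
      refine mul_le_mul_right ?_ _
      rw [coe_nnnorm_sq_eq_ofReal]
      exact ENNReal.ofReal_le_ofReal (pow_le_pow_left₀ (norm_nonneg _) ht 2)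
    · rw [lintegral_mul_const _ hWtm]
      exact ENNReal.mul_ne_top hWtint ENNReal.ofReal_ne_top
    · filter_upwards [hae, ae_lt_top hWtm hWtint] with t ht hWfin
      have hsq : Tendsto (fun i => (‖(P (φ i) : UnitAddTorus (Fin N × Fin 3) → ℂ) t‖₊ : ℝ≥0∞) ^ 2) atTop
          (𝓝 ((‖(f : UnitAddTorus (Fin N × Fin 3) → ℂ) t‖₊ : ℝ≥0∞) ^ 2)) :=
        ((ENNReal.continuous_pow 2).tendsto _).comp ((ENNReal.continuous_coe.tendsto _).comp ht.nnnorm)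
      exact ENNReal.Tendsto.const_mul hsq (Or.inr hWfin.ne)
  -- (vi) pick an index far enough along the subsequence
  have hev1 : ∀ᶠ i in atTop, POT (P (φ i)) ≤ POT f + ENNReal.ofReal ε := by
    by_cases htop : POT f = ⊤
    · exact Eventually.of_forall fun i => by rw [htop, top_add]; exact le_top
    · exact ((tendsto_order.1 hpot).2 _ (ENNReal.lt_add_right htop (by simpa using hε))).mono fun i hi => hi.le
  have hev2 : ∀ᶠ i in atTop, ‖P (φ i) - f‖ ≤ ε := by
    have h := (tendsto_iff_norm_sub_tendsto_zero.1 (hPf.comp hφ.tendsto_atTop)).eventually (Iic_mem_nhds hε)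
    exact h
  obtain ⟨i, hi1, hi2⟩ := (hev1.and hev2).exists
  have h5 := hkin (φ i)
  simp only [hKIN, hP] at h5
  simp only [hPOT, hWt, hP] at hi1
  simp only [hP] at hi2
  exact ⟨box (φ i), a (φ i), hboxσ (φ i), haσ (φ i), h5, hi1, hi2⟩

/-- **The maximal-form bound for bounded Bose-symmetric classes.** Let `L > 0`, `W` a measurable
weight with `∫_{[0,L)^{3N}} W < ∞`, and `f ∈ L²((ℝ/ℤ)^{3N})` with
`‖f‖ ≤ C` a.e. and Bose-symmetric Fourier coefficients. Then
`E₀(W') · ‖f‖² ≤ ∑ₙ (2πn/L)² |⟪eₙ, f⟫|² + ∫ (W ∘ fromUnitTorusN L) |f|²`.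
[cite: ReedSimonIV1978, Thm. XIII.64] -/
theorem periodicGroundStateEnergyW_mul_le_maxFormW_of_bound (hL : 0 < L) (hWm : Measurable W)
    (hW : ∫⁻ X in cellN N L, W X ≠ ⊤) (f : L2T N) {C : ℝ}
    (hC : ∀ᵐ t ∂(volume : Measure (UnitAddTorus (Fin N × Fin 3))), ‖(f : UnitAddTorus (Fin N × Fin 3) → ℂ) t‖ ≤ C)
    (hsymm : ∀ (σ : Equiv.Perm (Fin N)) (n : Fin N × Fin 3 → ℤ),
      ⟪(mFourierLp 2 (fun p : Fin N × Fin 3 => n (σ p.1, p.2)) : L2T N), f⟫_ℂ = ⟪(mFourierLp 2 n : L2T N), f⟫_ℂ) :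
    periodicGroundStateEnergyW W L * ENNReal.ofReal (‖f‖ ^ 2) ≤
      ∑' n : Fin N × Fin 3 → ℤ, ENNReal.ofReal (∑ p, (2 * Real.pi * (n p : ℝ) / L) ^ 2) *
          (‖⟪(mFourierLp 2 n : L2T N), f⟫_ℂ‖₊ : ℝ≥0∞) ^ 2 +
        ∫⁻ t, W (fromUnitTorusN L t) *
          (‖(f : UnitAddTorus (Fin N × Fin 3) → ℂ) t‖₊ : ℝ≥0∞) ^ 2 := by
  classical
  -- trivial when `f = 0`
  by_cases hf0 : ‖f‖ = 0
  · rw [hf0]; simp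
  -- the approximants at accuracy `1/(j+1)`
  have hδ : ∀ j : ℕ, (0 : ℝ) < 1 / ((j : ℝ) + 1) := fun j => by positivity
  choose S a hS ha hkin hpot hdist using fun j : ℕ => exists_symm_trigPoly_maxFormW_approx hL hWm hW f hC hsymm (hδ j)
  have hcore := fun j : ℕ => (periodicGroundStateEnergyW_mul_le_maxFormW_sum_smul hL hWm (hS j) (ha j)).trans
    ((add_le_add (hkin j) (hpot j)).trans_eq (add_assoc _ _ _).symm)
  set Q : ℝ≥0∞ := ∑' n : Fin N × Fin 3 → ℤ, ENNReal.ofReal (∑ p, (2 * Real.pi * (n p : ℝ) / L) ^ 2) *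
      (‖⟪(mFourierLp 2 n : L2T N), f⟫_ℂ‖₊ : ℝ≥0∞) ^ 2 +
    ∫⁻ t, W (fromUnitTorusN L t) * (‖(f : UnitAddTorus (Fin N × Fin 3) → ℂ) t‖₊ : ℝ≥0∞) ^ 2
    with hQ
  have hPf : Tendsto (fun j => ∑ m ∈ S j, a j m • (mFourierLp 2 m : L2T N)) atTop (𝓝 f) := by
    rw [tendsto_iff_norm_sub_tendsto_zero]
    exact squeeze_zero (fun j => norm_nonneg _) (fun j => hdist j) tendsto_one_div_add_atTop_nhds_zero_nat
  have hnorm : Tendsto (fun j => periodicGroundStateEnergyW W L *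
      ENNReal.ofReal (‖∑ m ∈ S j, a j m • (mFourierLp 2 m : L2T N)‖ ^ 2)) atTop
      (𝓝 (periodicGroundStateEnergyW W L * ENNReal.ofReal (‖f‖ ^ 2))) := by
    have h1 : Tendsto (fun j => ‖∑ m ∈ S j, a j m • (mFourierLp 2 m : L2T N)‖ ^ 2) atTop (𝓝 (‖f‖ ^ 2)) :=
      ((continuous_norm.tendsto f).comp hPf).pow 2
    refine ENNReal.Tendsto.const_mul ((ENNReal.continuous_ofReal.tendsto _).comp h1) (Or.inl ?_)
    rw [Ne, ENNReal.ofReal_eq_zero, not_le]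
    exact pow_pos (lt_of_le_of_ne (norm_nonneg f) (Ne.symm hf0)) 2
  have hrhs : Tendsto (fun j : ℕ => Q + ENNReal.ofReal (1 / ((j : ℝ) + 1))) atTop (𝓝 Q) := by
    have h := (ENNReal.continuous_ofReal.tendsto _).comp tendsto_one_div_add_atTop_nhds_zero_nat
    rw [ENNReal.ofReal_zero] at h
    have h2 := h.const_add Q
    rwa [add_zero] at h2
  exact le_of_tendsto_of_tendsto' hnorm hrhs hcore
/-! ### The maximal-form bound -/


/-- **The maximal-form bound, general Bose-symmetric class (integrable interaction).** For `L > 0`, a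
measurable weight `W` with `∫_{[0,L)^{3N}} W < ∞` and `η ∈ L²((ℝ/ℤ)^{3N})` Bose-symmetric in momentum
space, `E₀(W') · ‖η‖² ≤ ∑ₙ (2πn/L)² |⟪eₙ, η⟫|² + ∫ (W ∘ fromUnitTorusN L) |η|²`. [cite: ReedSimonIV1978, Thm. XIII.64] -/
theorem periodicGroundStateEnergyW_mul_le_maxFormW (hL : 0 < L) (hWm : Measurable W)
    (hW : ∫⁻ X in cellN N L, W X ≠ ⊤) (η : L2T N)
    (hsymm : ∀ (σ : Equiv.Perm (Fin N)) (n : Fin N × Fin 3 → ℤ),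
      ⟪(mFourierLp 2 (fun p : Fin N × Fin 3 => n (σ p.1, p.2)) : L2T N), η⟫_ℂ = ⟪(mFourierLp 2 n : L2T N), η⟫_ℂ) :
    periodicGroundStateEnergyW W L * ENNReal.ofReal (‖η‖ ^ 2) ≤
      ∑' n : Fin N × Fin 3 → ℤ, ENNReal.ofReal (∑ p, (2 * Real.pi * (n p : ℝ) / L) ^ 2) *
          (‖⟪(mFourierLp 2 n : L2T N), η⟫_ℂ‖₊ : ℝ≥0∞) ^ 2 +
        ∫⁻ t, W (fromUnitTorusN L t) *
          (‖(η : UnitAddTorus (Fin N × Fin 3) → ℂ) t‖₊ : ℝ≥0∞) ^ 2 := by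
  set f : ℕ → L2T N := fun k => (lipschitzWith_clampC (k : ℝ)).compLp (clampC_zero (Nat.cast_nonneg k)) η with hf
  -- the bounded case for each truncation
  have hk : ∀ k : ℕ, periodicGroundStateEnergyW W L * ENNReal.ofReal (‖f k‖ ^ 2) ≤
      ∑' n : Fin N × Fin 3 → ℤ, ENNReal.ofReal (∑ p, (2 * Real.pi * (n p : ℝ) / L) ^ 2) *
          (‖⟪(mFourierLp 2 n : L2T N), η⟫_ℂ‖₊ : ℝ≥0∞) ^ 2 +
        ∫⁻ t, W (fromUnitTorusN L t) *
          (‖(η : UnitAddTorus (Fin N × Fin 3) → ℂ) t‖₊ : ℝ≥0∞) ^ 2 := fun k =>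
    (periodicGroundStateEnergyW_mul_le_maxFormW_of_bound hL hWm hW (f k) (ae_norm_clampLp_le η k)
      (inner_symm_clampLp η k hsymm)).trans
      (add_le_add (tsum_kinetic_clampLp_le η k) (lintegral_pot_clampLp_le η k _))
  -- `‖f k‖² → ‖η‖²` as `ℝ≥0∞`-integrals
  have hnorm : ∀ x : L2T N, ENNReal.ofReal (‖x‖ ^ 2) = ∫⁻ t, ((‖(x : UnitAddTorus (Fin N × Fin 3) → ℂ) t‖₊ : ℝ≥0∞)) ^ 2 :=
    fun x => by rw [(norm_Lp_two_sq_eq_toReal x).1, ENNReal.ofReal_toReal (norm_Lp_two_sq_eq_toReal x).2]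
  simp only [hnorm] at hk ⊢
  by_cases h0 : ∫⁻ t, ((‖(η : UnitAddTorus (Fin N × Fin 3) → ℂ) t‖₊ : ℝ≥0∞)) ^ 2 = 0
  · rw [h0, mul_zero]
    exact zero_le
  have hlim := ENNReal.Tendsto.const_mul (tendsto_lintegral_clampLp_sq η) (Or.inl h0)
    (a := periodicGroundStateEnergyW W L)
  exact le_of_tendsto' hlim hk

/-- **MaxFormBound for integrable interactions** (the hypothesis `hcore` of the truncation argument, at a
fixed weight): for `L > 0`, measurable `W` with `∫_{[0,L)^{3N}} W < ∞`, and every UNIT `η ∈ L²((ℝ/ℤ)^{3N})`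
Bose-symmetric in momentum space,
`periodicGroundStateEnergyW W L ≤ ∑ₙ (2πn/L)² |⟪eₙ, η⟫|² + ∫ (W ∘ fromUnitTorusN L) |η|²`.
[cite: ReedSimonIV1978, Thm. XIII.64] -/
theorem periodicGroundStateEnergyW_le_maxFormW (hL : 0 < L) (hWm : Measurable W)
    (hW : ∫⁻ X in cellN N L, W X ≠ ⊤) (η : L2T N) (hη : ‖η‖ = 1)
    (hsymm : ∀ (σ : Equiv.Perm (Fin N)) (n : Fin N × Fin 3 → ℤ),
      ⟪(mFourierLp 2 (fun p : Fin N × Fin 3 => n (σ p.1, p.2)) : L2T N), η⟫_ℂ = ⟪(mFourierLp 2 n : L2T N), η⟫_ℂ) :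
    periodicGroundStateEnergyW W L ≤
      ∑' n : Fin N × Fin 3 → ℤ, ENNReal.ofReal (∑ p, (2 * Real.pi * (n p : ℝ) / L) ^ 2) *
          (‖⟪(mFourierLp 2 n : L2T N), η⟫_ℂ‖₊ : ℝ≥0∞) ^ 2 +
        ∫⁻ t, W (fromUnitTorusN L t) *
          (‖(η : UnitAddTorus (Fin N × Fin 3) → ℂ) t‖₊ : ℝ≥0∞) ^ 2 := by
  have h := periodicGroundStateEnergyW_mul_le_maxFormW hL hWm hW η hsymm
  rwa [hη, one_pow, ENNReal.ofReal_one, mul_one] at h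

end Literature.MathematicalPhysics.QuantumManyBody.BoseGas

end
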